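import Literature.MathematicalPhysics.QuantumFieldTheory.Balaban1983to89.B6MemberOfCubeV1L0
import Literature.MathematicalPhysics.QuantumFieldTheory.Balaban1983to89.B6MemberTorusTDomainsV1L0
import HarnessLib
import Literature.MathematicalPhysics.QuantumFieldTheory.Balaban1983to89.B6Geom246MultiLevelBoxL0
import Literature.MathematicalPhysics.QuantumFieldTheory.Balaban1983to89.B6GlobalChartV1L0
import Literature.MathematicalPhysics.QuantumFieldTheory.Balaban1983to89.B6MultiLevelTorusOperatorL0
import Literature.MathematicalPhysics.QuantumFieldTheory.Balaban1983to89.B6MemberLevelsWindow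

/-!
# `Balaban1983to89.B6MemberLevelsWindowL0` — LEVEL-0 TWIN (programme G-F3′-L0, director-ym LINE №27 / UV3-NODE §24.5; plan `lit-balaban-r03/G-F3L0-PLAN.md`) of `B6MemberLevelsWindow`:
the same declarations, SAME NAMES AND STATEMENTS, for nested families WITH print's region `Λ₀ = T ∖ Ω₁` ADMITTED (structures
`B6MultiLevelBoxOperatorL0.Domains` / `B6MultiLevelTorusOperatorL0.TDomains`: levels `0, …, k`, the level-`0` block a single site, `Q′₀ = id`,
finite weight `a₀` — print p.225 (2.14) «Σ_{j=0}^k … (Q′₀λ)(x) = λ(x), x ∈ Λ₀», p.229 «taking a sequence (2.1) … smallest possible domains B^j(Λ_j),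
and considering the operator Δ_a defined by (2.19), (2.20) for this sequence»).  Every `D`-free object is the lineage's, consumed BY NAME; no existing
module is touched; no fact is minted.  LEVEL-0 JOINT J7 (r03 19:28Z, binding): the member family `famOf M′ j P₁ R₁ Λ′` has no `1 ≤ j` binder, so `succ_le_lev_iff_of_cube`, `lam_tOf_sat`, `lev_famOf_tOf` lose their `(hj1 : 1 ≤ j)`; `iterBlockOf_mem_domT_iff` is guard-free.  Unit `lit-balaban-p21` (packet S-B owner, S-C tail; p21 gen 27; port tooling by r03 gen 36 / p33 gen 88); B6 fold owner r03; referee ref-4.  THE TWIN'S DOCUMENTATION FOLLOWS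
VERBATIM (its «levels 1 … k» / «Ω₁ = X» sentences describe the twin; here `j` runs from `0` and `Ω₁` may be a proper subset).

# [B6] Prop. 2.6, (2.89)–(2.90): THE LEVELS OF THE MEMBER FAMILY `famOf … Λ′(□)` OF A CUBE AGREE WITH THE GLOBAL LEVELS THROUGH THE WINDOW —
the hypotheses `hsat`, `hlevW` (and `hal`) of the line-3 member inputs (`B6GluedLegsWindowL0.member_line3_inputs`, `B6ScalarAgreeV1Chart`) for
r03's members `B6MemberOfCubeV1L0.tOf` / `B6CubeWindowV1.tC`

statement-level skeleton of published theorems with citation tags; proofs where landed; nothing here is a claim about the Yang–Mills mass gap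

[tag: formalized_from_source] (construction ours; print (2.89) p.239 *"B^j(Λ) = □̃² ∩ B^{j+1}(Λ_{j+1})"*, p.238 *"We take the cube □̃³ and
identify it with a torus"* [cite: Balaban1984PropagatorsII, (2.89)–(2.90) p.239, p.238].)

## What

For r03's member `t = tOf hN D hk wG c′ mt Kt j hj ha x₀` of a window with corner `x₀` (`Λ′(□) = e_{j+1}(Ω_{j+1} ∩ window)`, `LamOf`) and the p21
presentation `D₁ := famOf Mh₁ j P₁ R₁ t.Λ′` (LEVEL-0 JOINT J7: no `1 ≤ j`) of `B6MemberTorusTDomainsV1` (levels `j + 1` on `B^j(Λ′)`, `j` elsewhere), under the ALIGNMENT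
`M_{h,1}L^{j+2} ∣ x₀` and `M_{h,1} ∣ M_h` (r03: `M_{h,1} = M_h/L`, `x₀ ∈ S_j·ℤ`):
* `deepS_of_iterBlockOf_eq_zero` — the window is a union of `(j+1)`-blocks: the whole block of a window site is in the window;
* `bigLab_eSj_eq_iff` — two window `(j+1)`-blocks have the same member big block iff they lie in the same global cube of side `M_{h,1}L^{j+2}`;
* **`lam_tOf_sat`** (`hsat`): `Λ′(□)` is a union of member big blocks;
* **`lev_famOf_tOf`** (`hlevW`): for `x` in the window, `lev_{D₁}(toBox (e x)) = lev_D(toBox x)` — given the two-level window `hlev`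
  (`B6CubeWindowV1.hlev_deep`).

No measure, no Yang–Mills claim.
-/

open scoped BigOperators
open Finset

namespace Literature.MathematicalPhysics.QuantumFieldTheory.Balaban1983to89.B6MemberLevelsWindowL0

open B4Reflection242 (boxDom blk mem_boxDom blk_mem_boxDom)
open B6MultiLevelBoxOperator (N0 bigSide)
open B6MultiLevelTorusOperatorL0 (TDomains)
open B6Prop25TwoScaleCensus (TSIdx)
open B6GlobalChartV1 (PV toBox toBox_apply blk_toBox)
open B6GlobalChartV1L0 (domT iterBlockOf_mem_domT_iff)
open B5Eq118OneStroke (iterBlockOf iterBlock mem_iterBlock val_iterBlockOf)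
open B6AgreeLapV1Chart (eS DeepS deepS_mono)
open B6AgreeQaQV1Chart (eSj iterBlockOf_eS val_eSj iterBlockOf_window window_of_deep_block sitesPerDir_zero_eq_mul iterBlock_nonempty)
open B6MemberOfCubeV1 (memberOf LamOf lam_memberOf eSj_surj)
open B6MemberOfCubeV1L0 (tOf)
open B6MemberTorusTDomainsV1 (bigLab blk_bigSide_toBox)
open B6MemberTorusTDomainsV1L0 (famOf twoLevelT twoLevelT_lev lev_eq_or)
open B6Geom246MultiLevelBoxL0 (bset)
open B6LowerBound2153Torus (rep)
open Literature.MathematicalPhysics.QuantumFieldTheory.Balaban1983to89.B6MemberLevelsWindow (deepS_of_iterBlockOf_eq_zero bigLab_eSj bigLab_eSj_eq_iff blk_cube_toBox dvd_of_dvdB)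

variable {d ℓ : ℕ} {m K : ℕ} {hd : 1 ≤ d + 1} {hL : Odd (ℓ + 1) ∧ 1 < ℓ + 1} {a₀ a₁ : ℝ} {Mh k R : ℕ} {P' : Fin (d + 1) → ℕ}
variable (hN : ∀ μ, N0 ℓ Mh k P' μ = (PV d ℓ m K hd hL).sitesPerDir 0) (D : TDomains d ℓ Mh k P' R) (hk : k ≤ m + K)

/-! ## §1  Window arithmetic: aligned blocks of window sites stay in the window; member big labels through the level chart -/

section Arith

omit hN D hk in
/-- nested block labels: `⌊⌊z/a⌋/b⌋ = ⌊z/(ab)⌋`. [folklore] -/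
private theorem blk_blk (a b : ℕ) (z : Fin (d + 1) → ℤ) : blk b (blk a z) = blk (a * b) z := by
  funext μ
  simp only [blk]
  push_cast
  exact Int.ediv_ediv_of_nonneg (Int.natCast_nonneg a)

end Arith

/-! ## §2  `Λ′(□)` is big-block saturated; the member levels are the global levels -/

section Levels

variable (wG : B6SectAOperatorsV1.BondIdx (domT hN D hk) → ℝ) (c' : ℝ) (mt Kt j : ℕ) (hj : j + 1 ≤ mt + Kt) (ha : a₀ ≤ a₁)
  (x₀ : Fin (d + 1) → ℤ)

variable {hN D hk wG c' mt Kt j hj ha x₀}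

/-- same global `M′L^{j+2}`-cube ⇒ same global big `(j+1)`-block (`M′ ∣ M_h`), hence the same side of `Ω_{j+1}` ((2.1)).
[cite: Balaban1984PropagatorsII, (2.1) p.224, dictionary] -/
theorem succ_le_lev_iff_of_cube {Mh₁ : ℕ} (hMh : Mh₁ ∣ Mh) {x x' : Site (PV d ℓ m K hd hL) 0}
    (h : blk ((ℓ + 1) ^ (j + 1) * (Mh₁ * (ℓ + 1))) (toBox hN x : Fin (d + 1) → ℤ) =
      blk ((ℓ + 1) ^ (j + 1) * (Mh₁ * (ℓ + 1))) (toBox hN x' : Fin (d + 1) → ℤ)) :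
    j + 1 ≤ TDomains.lev D (toBox hN x : Fin (d + 1) → ℤ) ↔ j + 1 ≤ D.lev (toBox hN x' : Fin (d + 1) → ℤ) := by
  obtain ⟨q, hq⟩ := hMh
  have e : bigSide ℓ Mh (j + 1) = ((ℓ + 1) ^ (j + 1) * (Mh₁ * (ℓ + 1))) * q := by
    unfold bigSide; rw [hq]; ring
  have hb : blk (bigSide ℓ Mh (j + 1)) (toBox hN x' : Fin (d + 1) → ℤ) = blk (bigSide ℓ Mh (j + 1)) (toBox hN x : Fin (d + 1) → ℤ) := by
    rw [e, ← blk_blk ((ℓ + 1) ^ (j + 1) * (Mh₁ * (ℓ + 1))) q, ← blk_blk ((ℓ + 1) ^ (j + 1) * (Mh₁ * (ℓ + 1))) q, h]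
  exact D.bigBlocks (j + 1) (by omega) _ (toBox hN x).2 _ (toBox hN x').2 hb

/-- **`Λ′(□)` IS BIG-BLOCK SATURATED** (`hsat` of `B6MemberTorusTDomainsV1` / `B6ScalarFactorsChartV1` for the member family `famOf … Λ′(□)`):
two member `(j+1)`-sites with the same member big block are both in `Λ′(□)` or both out.
[cite: Balaban1984PropagatorsII, (2.89) p.239 («B^j(Λ) = □̃² ∩ B^{j+1}(Λ_{j+1})»), (2.1) p.224; derivation ours] -/
theorem lam_tOf_sat {Mh₁ : ℕ} (hjk : j + 1 ≤ k) (hx₀ : ∀ μ, 0 ≤ x₀ μ)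
    (hfit : ∀ μ, x₀ μ + ((B6MemberOfCubeV1L0.tOf hN D hk wG c' mt Kt j hj ha x₀).P.sitesPerDir 0 : ℕ) ≤ ((PV d ℓ m K hd hL).sitesPerDir 0 : ℕ))
    (hdivB : ∀ μ, ((((ℓ + 1) ^ (j + 1) * (Mh₁ * (ℓ + 1)) : ℕ) : ℤ)) ∣ x₀ μ) (hMh : Mh₁ ∣ Mh) (hM1 : 1 ≤ Mh₁)
    (Y Y' : Site (PV d ℓ mt Kt hd hL) (j + 1)) (h : bigLab Mh₁ Y = bigLab Mh₁ Y') :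
    Y ∈ (tOf hN D hk wG c' mt Kt j hj ha x₀).Λ' ↔ Y' ∈ (tOf hN D hk wG c' mt Kt j hj ha x₀).Λ' := by
  classical
  have hjm : j + 1 ≤ m + K := hjk.trans hk
  have hjt : j + 1 ≤ (tOf hN D hk wG c' mt Kt j hj ha x₀).m + (tOf hN D hk wG c' mt Kt j hj ha x₀).K := hj
  have hdiv : ∀ μ, ((((ℓ + 1) ^ (j + 1) : ℕ) : ℤ)) ∣ x₀ μ := dvd_of_dvdB hdivB
  -- both are charts of window blocks of window sites
  obtain ⟨x, hx, hxY⟩ := eSj_surj (t := tOf hN D hk wG c' mt Kt j hj ha x₀) hjm hjt hdiv hx₀ hfit Y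
  obtain ⟨x', hx', hxY'⟩ := eSj_surj (t := tOf hN D hk wG c' mt Kt j hj ha x₀) hjm hjt hdiv hx₀ hfit Y'
  have hblk : ∀ z, iterBlockOf (j + 1) z = iterBlockOf (j + 1) x → z ∈ DeepS (tOf hN D hk wG c' mt Kt j hj ha x₀) x₀ 0 :=
    fun z hz => deepS_of_iterBlockOf_eq_zero hjm hjt hdiv hx hz
  have hblk' : ∀ z, iterBlockOf (j + 1) z = iterBlockOf (j + 1) x' → z ∈ DeepS (tOf hN D hk wG c' mt Kt j hj ha x₀) x₀ 0 :=
    fun z hz => deepS_of_iterBlockOf_eq_zero hjm hjt hdiv hx' hz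
  -- `Λ′` membership ↔ `Ω_{j+1}` membership of the global block ↔ `j + 1 ≤ lev`
  have hΛ : ∀ {z : Site (PV d ℓ m K hd hL) 0},
      (∀ z', iterBlockOf (j + 1) z' = iterBlockOf (j + 1) z → z' ∈ DeepS (tOf hN D hk wG c' mt Kt j hj ha x₀) x₀ 0) →
      (eSj (tOf hN D hk wG c' mt Kt j hj ha x₀) x₀ (j + 1) (iterBlockOf (j + 1) z) ∈ (tOf hN D hk wG c' mt Kt j hj ha x₀).Λ' ↔
        j + 1 ≤ D.lev (toBox hN z : Fin (d + 1) → ℤ)) := by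
    intro z hzb
    rw [← iterBlockOf_mem_domT_iff hN D hk hjk z]
    exact lam_memberOf (mt := mt) (Kt := Kt) (j := j) (hj := hj) (ha := ha) (x₀ := x₀) hjm hdiv (iterBlockOf (j + 1) z) hzb
  -- the two global blocks lie in the same `M′L^{j+2}`-cube
  have hcube : blk ((ℓ + 1) ^ (j + 1) * (Mh₁ * (ℓ + 1))) (toBox hN x : Fin (d + 1) → ℤ) =
      blk ((ℓ + 1) ^ (j + 1) * (Mh₁ * (ℓ + 1))) (toBox hN x' : Fin (d + 1) → ℤ) := by
    rw [blk_cube_toBox hN Mh₁ hjm x, blk_cube_toBox hN Mh₁ hjm x']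
    rw [← hxY, ← hxY'] at h
    exact (bigLab_eSj_eq_iff (t := tOf hN D hk wG c' mt Kt j hj ha x₀) hM1 hdivB (iterBlockOf_window hjm hjt hdiv hx)
      (iterBlockOf_window hjm hjt hdiv hx')).1 h
  rw [← hxY, ← hxY']
  exact (hΛ hblk).trans ((succ_le_lev_iff_of_cube hMh hcube).trans (hΛ hblk').symm)

/-- **THE MEMBER LEVELS ARE THE GLOBAL LEVELS THROUGH THE WINDOW** (`hlevW` of `B6ScalarAgreeV1Chart` / `B6GluedLegsWindowL0.member_line3_inputs`
for `D₁ := famOf M′ j P₁ R₁ hj₁ Λ′(□)`): for every window site `x`, `lev_{D₁}(toBox (e x)) = lev_D(toBox x)`, given the two-level window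
`j ≤ lev_D ≤ j + 1` there (r03's `hlev_deep`). [cite: Balaban1984PropagatorsII, (2.89)–(2.90) p.239, p.238; derivation ours] -/
theorem lev_famOf_tOf {Mh₁ : ℕ} (hjk : j + 1 ≤ k) (hx₀ : ∀ μ, 0 ≤ x₀ μ)
    (hfit : ∀ μ, x₀ μ + ((B6MemberOfCubeV1L0.tOf hN D hk wG c' mt Kt j hj ha x₀).P.sitesPerDir 0 : ℕ) ≤ ((PV d ℓ m K hd hL).sitesPerDir 0 : ℕ))
    (hdivB : ∀ μ, ((((ℓ + 1) ^ (j + 1) * (Mh₁ * (ℓ + 1)) : ℕ) : ℤ)) ∣ x₀ μ) (hMh : Mh₁ ∣ Mh) (hM1 : 1 ≤ Mh₁) {P₁ : Fin (d + 1) → ℕ} {R₁ : ℕ}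
    (hN₁ : ∀ μ, N0 ℓ Mh₁ (j + 1) P₁ μ = (PV d ℓ mt Kt hd hL).sitesPerDir 0)
    (hlev : ∀ x : Site (PV d ℓ m K hd hL) 0, x ∈ DeepS (tOf hN D hk wG c' mt Kt j hj ha x₀) x₀ 0 →
      j ≤ D.lev (toBox hN x : Fin (d + 1) → ℤ) ∧ D.lev (toBox hN x : Fin (d + 1) → ℤ) ≤ j + 1)
    {x : Site (PV d ℓ m K hd hL) 0} (hx : x ∈ DeepS (tOf hN D hk wG c' mt Kt j hj ha x₀) x₀ 0) :
    (famOf Mh₁ j P₁ R₁ (tOf hN D hk wG c' mt Kt j hj ha x₀).Λ').lev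
        (toBox hN₁ (eS (tOf hN D hk wG c' mt Kt j hj ha x₀) x₀ x) : Fin (d + 1) → ℤ) =
      D.lev (toBox hN x : Fin (d + 1) → ℤ) := by
  classical
  have hjm : j + 1 ≤ m + K := hjk.trans hk
  have hjt : j + 1 ≤ (tOf hN D hk wG c' mt Kt j hj ha x₀).m + (tOf hN D hk wG c' mt Kt j hj ha x₀).K := hj
  have hdiv : ∀ μ, ((((ℓ + 1) ^ (j + 1) : ℕ) : ℤ)) ∣ x₀ μ := dvd_of_dvdB hdivB
  have hblk : ∀ z, iterBlockOf (j + 1) z = iterBlockOf (j + 1) x → z ∈ DeepS (tOf hN D hk wG c' mt Kt j hj ha x₀) x₀ 0 :=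
    fun z hz => deepS_of_iterBlockOf_eq_zero hjm hjt hdiv hx hz
  show (B6MemberTorusTDomainsV1L0.twoLevelT ℓ Mh₁ j P₁ R₁ ((tOf hN D hk wG c' mt Kt j hj ha x₀).Λ'.image (bigLab Mh₁))).lev _ = _
  have eblk : (iterBlockOf (P := PV d ℓ mt Kt hd hL) (j + 1) (eS (tOf hN D hk wG c' mt Kt j hj ha x₀) x₀ x) : Site (PV d ℓ mt Kt hd hL) (j + 1)) =
      eSj (tOf hN D hk wG c' mt Kt j hj ha x₀) x₀ (j + 1) (iterBlockOf (j + 1) x) :=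
    iterBlockOf_eS hjm hjt hdiv hx
  rw [twoLevelT_lev, blk_bigSide_toBox hN₁ hjt, eblk]
  -- membership of the big label in `bigLab″Λ′` ↔ membership of the block in `Λ′` (saturation) ↔ `j + 1 ≤ lev`
  have hmemΛ : eSj (tOf hN D hk wG c' mt Kt j hj ha x₀) x₀ (j + 1) (iterBlockOf (j + 1) x) ∈ (tOf hN D hk wG c' mt Kt j hj ha x₀).Λ' ↔
      j + 1 ≤ D.lev (toBox hN x : Fin (d + 1) → ℤ) := by
    rw [← iterBlockOf_mem_domT_iff hN D hk hjk x]
    exact lam_memberOf (mt := mt) (Kt := Kt) (j := j) (hj := hj) (ha := ha) (x₀ := x₀) hjm hdiv (iterBlockOf (j + 1) x) hblk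
  have key : bigLab Mh₁ (eSj (tOf hN D hk wG c' mt Kt j hj ha x₀) x₀ (j + 1) (iterBlockOf (j + 1) x)) ∈
      (tOf hN D hk wG c' mt Kt j hj ha x₀).Λ'.image (bigLab Mh₁) ↔ j + 1 ≤ D.lev (toBox hN x : Fin (d + 1) → ℤ) := by
    rw [Finset.mem_image, ← hmemΛ]
    constructor
    · rintro ⟨Y, hY, hlab⟩
      exact (lam_tOf_sat hjk hx₀ hfit hdivB hMh hM1 Y _ hlab).1 hY
    · intro hl
      exact ⟨_, hl, rfl⟩
  obtain ⟨h1, h2⟩ := hlev x hx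
  split_ifs with hc
  · have := key.1 hc; omega
  · have : ¬ j + 1 ≤ D.lev (toBox hN x : Fin (d + 1) → ℤ) := fun h => hc (key.2 h); omega

end Levels

/-! ## §3  The member block set is small: `|𝔅(T_□)| ≤ 2·Π_μ (M′L²P₁μ)` (uniform in `j`; polynomial in `M`) -/

section Card

omit hN D hk

/-- the box has `Π_μ N_μ` points. [folklore] -/
private theorem card_boxDom (N : Fin (d + 1) → ℕ) : (boxDom N).card = ∏ μ, N μ := by
  unfold boxDom
  rw [Fintype.card_piFinset]
  refine Finset.prod_congr rfl fun μ _ => ?_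
  rw [Int.card_Ico]; simp

/-- the level-`i` labels of the box `N = b·M` (coordinatewise) number at most `Π_μ M_μ`. [folklore] -/
private theorem card_image_blk_le {b : ℕ} (hb : 1 ≤ b) (M : Fin (d + 1) → ℕ) (i : ℕ) :
    ((boxDom (fun μ => b * M μ)).image fun x => (i, blk b x)).card ≤ ∏ μ, M μ := by
  classical
  rw [← card_boxDom M]
  refine Finset.card_le_card_of_injOn (fun p => p.2) (fun p hp => ?_) (fun p hp p' hp' h => ?_)
  · obtain ⟨x, hx, rfl⟩ := Finset.mem_image.1 hp
    exact blk_mem_boxDom hb hx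
  · obtain ⟨x, -, rfl⟩ := Finset.mem_image.1 (Finset.mem_coe.1 hp)
    obtain ⟨x', -, rfl⟩ := Finset.mem_image.1 (Finset.mem_coe.1 hp')
    simp only at h
    rw [h]

/-- **THE MEMBER TORUS HAS FEW BLOCKS**: the block set of the two-level family `famOf M′ j P₁ R₁ hj Λ′` (levels `j`, `j+1` on the box
`N₀ = M′L^{j+2}P₁`) has at most `2·Π_μ (M′·L²·P₁ μ)` elements — uniform in `j` and polynomial in `M` (the size entering the `d′`-profile constant of
`B6GluedDistWindowL0.profileW`, to be absorbed into `e^{−cM}`). [cite: Balaban1984PropagatorsII, (2.45) p.231, p.238 (T_□); bookkeeping ours] -/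
theorem card_bset_famOf_le {mt Kt j Mh₁ R₁ : ℕ} {P₁ : Fin (d + 1) → ℕ} (Λ' : Finset (Site (PV d ℓ mt Kt hd hL) (j + 1))) :
    (B6Geom246MultiLevelBoxL0.bset (famOf Mh₁ j P₁ R₁ Λ').toDomains).card ≤ 2 * ∏ μ, (Mh₁ * (ℓ + 1) ^ 2 * P₁ μ) := by
  classical
  have hL1 : 1 ≤ ℓ + 1 := by omega
  -- the box as `L^j · (M′L²P₁)` and as `L^{j+1} · (M′LP₁)`
  have eN : ∀ μ, N0 ℓ Mh₁ (j + 1) P₁ μ = (ℓ + 1) ^ j * (Mh₁ * (ℓ + 1) ^ 2 * P₁ μ) := by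
    intro μ; unfold N0; ring
  have eN' : ∀ μ, N0 ℓ Mh₁ (j + 1) P₁ μ = (ℓ + 1) ^ (j + 1) * (Mh₁ * (ℓ + 1) * P₁ μ) := by
    intro μ; unfold N0; ring
  have hsub : bset (famOf Mh₁ j P₁ R₁ Λ').toDomains ⊆
      ((boxDom fun μ => (ℓ + 1) ^ j * (Mh₁ * (ℓ + 1) ^ 2 * P₁ μ)).image fun x => (j, blk ((ℓ + 1) ^ j) x)) ∪
        ((boxDom fun μ => (ℓ + 1) ^ (j + 1) * (Mh₁ * (ℓ + 1) * P₁ μ)).image fun x => (j + 1, blk ((ℓ + 1) ^ (j + 1)) x)) := by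
    intro p hp
    unfold bset at hp
    obtain ⟨x, hx, rfl⟩ := Finset.mem_image.1 hp
    have hx1 : x ∈ boxDom fun μ => (ℓ + 1) ^ j * (Mh₁ * (ℓ + 1) ^ 2 * P₁ μ) := by
      have e : (fun μ => (ℓ + 1) ^ j * (Mh₁ * (ℓ + 1) ^ 2 * P₁ μ)) = N0 ℓ Mh₁ (j + 1) P₁ := funext fun μ => (eN μ).symm
      rw [e]; exact hx
    have hx2 : x ∈ boxDom fun μ => (ℓ + 1) ^ (j + 1) * (Mh₁ * (ℓ + 1) * P₁ μ) := by
      have e : (fun μ => (ℓ + 1) ^ (j + 1) * (Mh₁ * (ℓ + 1) * P₁ μ)) = N0 ℓ Mh₁ (j + 1) P₁ := funext fun μ => (eN' μ).symm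
      rw [e]; exact hx
    show ((famOf Mh₁ j P₁ R₁ Λ').toDomains.lev x, blk ((ℓ + 1) ^ (famOf Mh₁ j P₁ R₁ Λ').toDomains.lev x) x) ∈ _
    rw [B6MultiLevelTorusOperatorL0.TDomains.toDomains_lev]
    rcases lev_eq_or (P := P₁) (R := R₁) (ℓ := ℓ) (Mh := Mh₁) (j := j) (Λ'.image (bigLab Mh₁)) x with h | h
    · rw [show (famOf Mh₁ j P₁ R₁ Λ').lev x = j from h]
      exact Finset.mem_union_left _ (Finset.mem_image_of_mem _ hx1)
    · rw [show (famOf Mh₁ j P₁ R₁ Λ').lev x = j + 1 from h]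
      exact Finset.mem_union_right _ (Finset.mem_image_of_mem _ hx2)
  refine (Finset.card_le_card hsub).trans ((Finset.card_union_le _ _).trans ?_)
  have h1 := card_image_blk_le (d := d) (Nat.one_le_pow _ _ hL1 : 1 ≤ (ℓ + 1) ^ j) (fun μ => Mh₁ * (ℓ + 1) ^ 2 * P₁ μ) j
  have h2 := card_image_blk_le (d := d) (Nat.one_le_pow _ _ hL1 : 1 ≤ (ℓ + 1) ^ (j + 1)) (fun μ => Mh₁ * (ℓ + 1) * P₁ μ) (j + 1)
  have h3 : ∏ μ, (Mh₁ * (ℓ + 1) * P₁ μ) ≤ ∏ μ, (Mh₁ * (ℓ + 1) ^ 2 * P₁ μ) :=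
    Finset.prod_le_prod' fun μ _ => Nat.mul_le_mul_right _ (Nat.mul_le_mul_left _ (by nlinarith))
  omega

end Card

end Literature.MathematicalPhysics.QuantumFieldTheory.Balaban1983to89.B6MemberLevelsWindowL0
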